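import Summits.QuantumFields.BalabanUV.T4Continuum.Spine.NE4.KingCurrency
import Summits.QuantumFields.BalabanUV.T4Continuum.Spine.NE4.KingCurrencyAF
import Summits.QuantumFields.BalabanUV.T4Continuum.Spine.NE9.DirectPairing
import Literature.MathematicalPhysics.QuantumFieldTheory.Balaban1983to89.T4BetaStationary

/-!
# Spine/NE4/KingCurrencyNecessity — node U2's King-currency output is NOT BYPASSABLE on the β-side either: direct matching of the
# pinned runs at every fixed infrared depth FORCES the n-shift modulus to vanish along the realised coupling histories

Cell `pub-balaban-gaps` (YM blitz G2), seat `ne4` generation 14 (unit `pub-balaban-gaps-ne4-g14`), record `HOME/ne/NE4.md` §5 census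
item (R52)(iii); the King-currency analogue of generation 2's `Spine/NE4/Necessity.ne4AlongRuns_of_u2Output` ((R26): in the CONSECUTIVE
currency node U2's output forces NE4 along the tuned runs).  Imports `Spine/NE4/KingCurrency` (`UniformShift`, the shapes) and elementary
helpers only; NOTHING of Bałaban's asserted.

THE POINT.  `KingCurrencyWindow.direct_matching_eventually` ∕ `KingCurrencyGapEnd.direct_matching_eventually_gap` produce, from the β-side
input `UniformShift ω γ β` (`ω → 0`) + the memory companion (+ binders), the KING OUTPUT: for every depth `M` and `ε > 0`, eventually in the
cutoff `K` and uniformly in the gap `n`, `|g^{(K+n)}_{j+n} − g^{(K)}_j| ≤ ε` for `K − M ≤ j ≤ K`.  CONVERSELY (this file): if a family of runs of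
(0.20) in the box, pinned at one renormalized coupling, HAS the King output, then — given only the printed-type bound `|β| ≤ B` and the memory
companion `HistLipschitz Λ γ β` + `FadingMemory C θ Λ` — the n-SHIFT of the β-functions VANISHES ALONG THE REALISED HISTORIES: for every depth
`M` and `ε > 0`, eventually in `K` and uniformly in `n`, `|β_{j+n}(g^{(K+n)}_0,…,g^{(K+n)}_{j+n}) − β_j(g^{(K+n)}_n,…,g^{(K+n)}_{j+n})| ≤ ε` for
`K − M ≤ j < K` (`shift_along_runs_of_matching`).  Mechanism: (0.20) reads `β_j = x_j − x_{j+1}` (`x = 1∕g²`) along each run, the couplings at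
bounded depth are bounded BELOW by the pin and the bound on β (`inv_sq_le_depth`: `1∕g_j² ≤ 1∕g_IR² + (K−j)·B`), so coupling matching is
x-matching there (`abs_inv_sq_sub_le`); and the history of run `K` is exchanged for the shifted history of run `K + n` by the memory companion —
young ages matched, old ages damped by `θ^{age}`.  So on King's route, exactly as on the consecutive one, node U2's β-side input (in its
along-the-runs form) is EQUIVALENT to node U2's output modulo the memory companion and the printed-type bound: NOT BYPASSABLE.

WHAT IS KERNEL-CHECKED (elementary real analysis):
* `inv_sq_le_depth` — along a run of (0.20) in the box with `|β| ≤ B` on the boxes: `1∕(g_j)² ≤ 1∕(g_K)² + (K − j)·B`.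
* `abs_inv_sq_sub_le` — for `0 < a, b ≤ γ` with `1∕a², 1∕b² ≤ X`: `|1∕a² − 1∕b²| ≤ 2γX²·|a − b|`.
* `shift_along_runs_of_matching` — THE NECESSITY, as displayed above.

WHAT THIS SAYS FOR THE ROW (R52)(iii).  With (i) (AF-free sufficiency) and (ii) (the window is necessary), (iii) closes the circle in King's
currency as (R26) did in the consecutive one: the β-side input of node U2 cannot be weakened below «the n-shift vanishes along the realised
histories», because the output re-derives it.  NE4 PROPER unchanged: NOT PRINTED, NOT PROVED, DEPENDENT; spine PROVED 0∕9 before and after.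

HONEST FRAMING.  Hypothesis SHAPES only (0 sorry, standard axioms); every β-side shape is an UNPRINTED binder; nothing of Bałaban's is
asserted or instantiated; rung (B)+1 on ONE finite T⁴ — NOT ℝ⁴, NOT infinite volume, NOT a mass gap, NOT Clay.

References (TYPES only): [Balaban1987RG1] = T. Bałaban, Commun. Math. Phys. **109** (1987) 249–301, (0.20) p. 256, Thm 2 p. 259, §1
p. 264 («uniformly bounded»), §5 p. 298.
-/

noncomputable section

namespace Summit.QuantumFields.BalabanUV.T4Continuum.Spine.NE4.KingCurrencyNecessity

open Finset Filter Topology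
open Literature.MathematicalPhysics.QuantumFieldTheory.Balaban1983to89
open Literature.MathematicalPhysics.QuantumFieldTheory.Balaban1983to89.FlowStep
open Literature.MathematicalPhysics.QuantumFieldTheory.Balaban1983to89.T4CouplingMatching
open Literature.MathematicalPhysics.QuantumFieldTheory.Balaban1983to89.T4BetaStationary (constant_nonneg_of_fadingMemory)
open Summit.QuantumFields.BalabanUV.T4Continuum.Spine.NE4.KingCurrency
open Summit.QuantumFields.BalabanUV.T4Continuum.Spine.NE4.KingCurrencyAF (abs_sub_le_of_pos_le sum_range_pow_sub_le)
open Summit.QuantumFields.BalabanUV.T4Continuum.NE9.DirectPairing (exists_pow_le)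

/-! ## §1 Elementary helpers: couplings at bounded depth are bounded below; coupling matching is x-matching there -/

/-- Along a run of (0.20) with couplings in `]0,γ]` up to scale `K` and `|β_{k+1}| ≤ B` on the boxes: `1∕(g_j)² ≤ 1∕(g_K)² + (K − j)·B` for
`j ≤ K` (the recursion variable grows by at most `B` per step towards the ultraviolet). [cite: Balaban1987RG1, (0.20) p.256 and §1 p.264] -/
theorem inv_sq_le_depth {β : HBeta} {γ B : ℝ} {K : ℕ} {g : ℕ → ℝ} (hrun : RGEqH K β g)
    (hbox : ∀ i, i ≤ K → 0 < g i ∧ g i ≤ γ) (hB : ∀ k (v : Fin (k + 1) → ℝ), v ∈ Box γ k → |β k v| ≤ B) :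
    ∀ j, j ≤ K → 1 / (g j) ^ 2 ≤ 1 / (g K) ^ 2 + ((K : ℝ) - j) * B := by
  suffices H : ∀ d j, j + d = K → 1 / (g j) ^ 2 ≤ 1 / (g K) ^ 2 + (d : ℝ) * B by
    intro j hj
    have h := H (K - j) j (by omega)
    have e : ((K - j : ℕ) : ℝ) = (K : ℝ) - j := by
      rw [Nat.cast_sub hj]
    rwa [e] at h
  intro d
  induction d with
  | zero =>
    intro j hj
    rw [add_zero] at hj
    subst hj
    simp
  | succ d ih =>
    intro j hj
    have hjK : j < K := by omega
    have h1 := hrun j hjK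
    have h2 := ih (j + 1) (by omega)
    have hbnd := hB j (prefixOf g j) (prefixOf_mem_box hjK.le hbox)
    have h3 : β j (prefixOf g j) ≤ B := (le_abs_self _).trans hbnd
    rw [h1]
    push_cast
    linarith

/-- Coupling matching is x-matching where the couplings are bounded below: for `0 < a, b ≤ γ` with `1∕a² ≤ X`, `1∕b² ≤ X`,
`|1∕a² − 1∕b²| ≤ 2γX²·|a − b|` (`1∕a² − 1∕b² = (b − a)(a + b)∕(a²b²)`). [folklore] -/
theorem abs_inv_sq_sub_le {a b γ X : ℝ} (ha : 0 < a) (haγ : a ≤ γ) (hb : 0 < b) (hbγ : b ≤ γ)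
    (haX : 1 / a ^ 2 ≤ X) (hbX : 1 / b ^ 2 ≤ X) :
    |1 / a ^ 2 - 1 / b ^ 2| ≤ 2 * γ * X ^ 2 * |a - b| := by
  have ha2 : 0 < 1 / a ^ 2 := by positivity
  have hb2 : 0 < 1 / b ^ 2 := by positivity
  have hX : 0 < X := ha2.trans_le haX
  have key : 1 / a ^ 2 - 1 / b ^ 2 = (b - a) * ((a + b) * (1 / a ^ 2 * (1 / b ^ 2))) := by
    field_simp
    ring
  have hfac : (a + b) * (1 / a ^ 2 * (1 / b ^ 2)) ≤ 2 * γ * X ^ 2 := by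
    have h1 : a + b ≤ 2 * γ := by linarith
    have h2 : 1 / a ^ 2 * (1 / b ^ 2) ≤ X * X := mul_le_mul haX hbX hb2.le hX.le
    calc (a + b) * (1 / a ^ 2 * (1 / b ^ 2)) ≤ 2 * γ * (X * X) :=
          mul_le_mul h1 h2 (by positivity) (by linarith)
      _ = 2 * γ * X ^ 2 := by ring
  have hfac0 : 0 ≤ (a + b) * (1 / a ^ 2 * (1 / b ^ 2)) := by positivity
  rw [key, abs_mul, abs_of_nonneg hfac0, abs_sub_comm b a]
  calc |a - b| * ((a + b) * (1 / a ^ 2 * (1 / b ^ 2))) ≤ |a - b| * (2 * γ * X ^ 2) :=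
        mul_le_mul_of_nonneg_left hfac (abs_nonneg _)
    _ = 2 * γ * X ^ 2 * |a - b| := by ring

/-! ## §2 The necessity: the King output forces the n-shift to vanish along the realised histories -/

/-- **NODE U2's KING OUTPUT IS NOT BYPASSABLE ON THE β-SIDE.**  A family of runs `K ↦ g^{(K)}` of (0.20) with the same history-dependent `β`,
couplings in `]0,γ]`, pinned at one renormalized coupling (`g K K = g_IR`); the printed-type bound `|β_{k+1}| ≤ B` on the boxes; the memory
companion `HistLipschitz Λ γ β` with `FadingMemory C θ Λ` (`0 ≤ θ < 1`).  IF the family has the KING OUTPUT — for every depth `M` and `ε > 0`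
there is `K₀` with `|g^{(K+n)}_{j+n} − g^{(K)}_j| ≤ ε` for all `K ≥ K₀`, all `n`, `K − M ≤ j ≤ K` (the conclusion of
`KingCurrencyWindow.direct_matching_eventually` ∕ `KingCurrencyGapEnd.direct_matching_eventually_gap`) — THEN the n-shift modulus VANISHES ALONG
THE REALISED HISTORIES: for every depth `M` and `ε > 0` there is `K₀` with
`|β (j+n) (g^{(K+n)}_0,…,g^{(K+n)}_{j+n}) − β j (g^{(K+n)}_n,…,g^{(K+n)}_{j+n})| ≤ ε` for all `K ≥ K₀`, all `n`, `K − M ≤ j < K`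
— `KingCurrency.UniformShift` restricted to where the matching uses it.  ((0.20): `β_j = x_j − x_{j+1}` along each run; `inv_sq_le_depth` +
`abs_inv_sq_sub_le` turn coupling matching into x-matching at bounded depth; the memory companion exchanges run `K`'s history for run
`K + n`'s shifted one — young ages matched, old ages damped.)  The King-currency analogue of `Spine/NE4/Necessity.ne4AlongRuns_of_u2Output`.
Every hypothesis about `β` is an UNPRINTED input. [cite: Balaban1987RG1, (0.20) p.256, Thm 2 p.259, §1 p.264, §5 p.298] -/
theorem shift_along_runs_of_matching {β : HBeta} {γ θ C B : ℝ} {Λ : ℕ → ℕ → ℝ}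
    (g : ℕ → ℕ → ℝ) (gIR : ℝ) (hγ : 0 < γ) (hθ0 : 0 ≤ θ) (hθ1 : θ < 1)
    (hrun : ∀ K, RGEqH K β (g K)) (hbox : ∀ K i, i ≤ K → 0 < g K i ∧ g K i ≤ γ) (hpin : ∀ K, g K K = gIR)
    (hB : ∀ k (v : Fin (k + 1) → ℝ), v ∈ Box γ k → |β k v| ≤ B)
    (hL : HistLipschitz Λ γ β) (hΛ : FadingMemory C θ Λ)
    (hKO : ∀ (M : ℕ) (ε : ℝ), 0 < ε → ∃ K₀ : ℕ, ∀ K n j : ℕ, K₀ ≤ K → K ≤ j + M → j ≤ K →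
      |g (K + n) (j + n) - g K j| ≤ ε) :
    ∀ (M : ℕ) (ε : ℝ), 0 < ε → ∃ K₀ : ℕ, ∀ K n j : ℕ, K₀ ≤ K → K ≤ j + M → j < K →
      |β (j + n) (prefixOf (g (K + n)) (j + n)) - β j (prefixOf (fun i => g (K + n) (i + n)) j)| ≤ ε := by
  intro M ε hε
  have hC : 0 ≤ C := constant_nonneg_of_fadingMemory hΛ
  have h1θ : 0 < 1 - θ := by linarith
  have hgIR : 0 < gIR := by rw [← hpin 0]; exact (hbox 0 0 le_rfl).1
  have hB0 : 0 ≤ B := (abs_nonneg _).trans (hB 0 (fun _ => γ) (mem_box.mpr fun _ => ⟨hγ, le_rfl⟩))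
  -- the lower bound on the couplings at depth ≤ M + 1, as an upper bound `X` on the recursion variable
  set X : ℝ := 1 / gIR ^ 2 + ((M : ℝ) + 1) * B with hX
  have hXpos : 0 < X := by positivity
  have hxle : ∀ K j, j ≤ K → K ≤ j + (M + 1) → 1 / (g K j) ^ 2 ≤ X := by
    intro K j hjK hKj
    have h := inv_sq_le_depth (hrun K) (hbox K) hB j hjK
    rw [hpin K] at h
    have hd : ((K : ℝ) - j) * B ≤ ((M : ℝ) + 1) * B := by
      refine mul_le_mul_of_nonneg_right ?_ hB0
      have : (K : ℝ) ≤ (j : ℝ) + (M + 1 : ℕ) := by exact_mod_cast hKj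
      push_cast at this
      linarith
    linarith
  -- (a) the old ages: damped by the fading memory
  set c₁ : ℝ := C * γ * (θ / (1 - θ)) with hc₁
  obtain ⟨A, hA⟩ := exists_pow_le c₁ hθ0 hθ1 (ε := ε / 3) (by positivity)
  -- (b)+(c) the young ages and the two x-differences: matching at depth ≤ M + A + 1 within `δ`
  set L₁ : ℝ := 4 * γ * X ^ 2 + C / (1 - θ) + 1 with hL₁
  have hL₁pos : 0 < L₁ := by positivity
  set δ : ℝ := ε / 3 / L₁ with hδ
  have hδpos : 0 < δ := by positivity
  obtain ⟨K₀, hK₀⟩ := hKO (M + A + 1) δ hδpos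
  refine ⟨K₀ + M + A + 1, fun K n j hK hjM hjK => ?_⟩
  -- notation: run K (`a`), run K + n read at the matched scales (`b`)
  have hjK' : j + 1 ≤ K := hjK
  have hmatch : ∀ i, i ≤ K → K ≤ i + (M + A + 1) → |g (K + n) (i + n) - g K i| ≤ δ :=
    fun i hi hKi => hK₀ K n i (by omega) hKi hi
  -- (b) β along the runs as x-differences, (0.20)
  have eA : β j (prefixOf (g K) j) = 1 / (g K j) ^ 2 - 1 / (g K (j + 1)) ^ 2 := by
    have h := hrun K j hjK
    linarith
  have eB : β (j + n) (prefixOf (g (K + n)) (j + n))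
      = 1 / (g (K + n) (j + n)) ^ 2 - 1 / (g (K + n) (j + n + 1)) ^ 2 := by
    have h := hrun (K + n) (j + n) (by omega)
    linarith
  have hxj := abs_inv_sq_sub_le (hbox (K + n) (j + n) (by omega)).1 (hbox (K + n) (j + n) (by omega)).2
    (hbox K j hjK.le).1 (hbox K j hjK.le).2
    (by have h := hxle (K + n) (j + n) (by omega) (by omega); exact h) (hxle K j hjK.le (by omega))
  have hxj1 := abs_inv_sq_sub_le (hbox (K + n) (j + n + 1) (by omega)).1 (hbox (K + n) (j + n + 1) (by omega)).2
    (hbox K (j + 1) hjK').1 (hbox K (j + 1) hjK').2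
    (by have h := hxle (K + n) (j + n + 1) (by omega) (by omega); exact h) (hxle K (j + 1) hjK' (by omega))
  have hm0 := hmatch j hjK.le (by omega)
  have hm1 : |g (K + n) (j + n + 1) - g K (j + 1)| ≤ δ := by
    have h := hmatch (j + 1) hjK' (by omega)
    rwa [show j + 1 + n = j + n + 1 by omega] at h
  have hγX : 0 ≤ 2 * γ * X ^ 2 := by positivity
  have hpartB : |β (j + n) (prefixOf (g (K + n)) (j + n)) - β j (prefixOf (g K) j)| ≤ 4 * γ * X ^ 2 * δ := by
    rw [eA, eB]
    have e : 1 / g (K + n) (j + n) ^ 2 - 1 / g (K + n) (j + n + 1) ^ 2 - (1 / g K j ^ 2 - 1 / g K (j + 1) ^ 2)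
        = (1 / g (K + n) (j + n) ^ 2 - 1 / g K j ^ 2) - (1 / g (K + n) (j + n + 1) ^ 2 - 1 / g K (j + 1) ^ 2) := by ring
    rw [e]
    refine (abs_sub _ _).trans ?_
    have h1 := hxj.trans (mul_le_mul_of_nonneg_left hm0 hγX)
    have h2 := hxj1.trans (mul_le_mul_of_nonneg_left hm1 hγX)
    linarith
  -- (a)+(c) exchange run K's history for run K+n's shifted one, by the memory companion
  have hpA : prefixOf (g K) j ∈ Box γ j := prefixOf_mem_box hjK.le (hbox K)
  have hpB : prefixOf (fun i => g (K + n) (i + n)) j ∈ Box γ j :=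
    prefixOf_mem_box (N := K) hjK.le fun i hi => hbox (K + n) (i + n) (by omega)
  have hhist := hL j (prefixOf (g K) j) (prefixOf (fun i => g (K + n) (i + n)) j) hpA hpB
  have hsum : ∑ i : Fin (j + 1), Λ j i * |prefixOf (g K) j i - prefixOf (fun i => g (K + n) (i + n)) j i|
      = ∑ i ∈ range (j + 1), Λ j i * |g K i - g (K + n) (i + n)| := by
    rw [Finset.sum_range (fun i => Λ j i * |g K i - g (K + n) (i + n)|)]
    simp only [prefixOf_apply]
  rw [hsum] at hhist
  set J := j - A with hJ
  have hsplit : ∑ i ∈ range (j + 1), Λ j i * |g K i - g (K + n) (i + n)|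
      = ∑ i ∈ range J, Λ j i * |g K i - g (K + n) (i + n)|
        + ∑ i ∈ Ico J (j + 1), Λ j i * |g K i - g (K + n) (i + n)| :=
    (Finset.sum_range_add_sum_Ico _ (by omega : J ≤ j + 1)).symm
  have hold : ∑ i ∈ range J, Λ j i * |g K i - g (K + n) (i + n)| ≤ c₁ * θ ^ A := by
    -- each old coupling difference is ≤ γ; the moduli are ≤ C θ^{j-i} with j - i ≥ A + (J - i)
    have hterm : ∀ i ∈ range J, Λ j i * |g K i - g (K + n) (i + n)| ≤ C * γ * θ ^ A * θ ^ (J - i) := by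
      intro i hi
      have hiJ : i < J := mem_range.mp hi
      have hij : i ≤ j := by omega
      have hΛi := hΛ j i hij
      have hgA := hbox K i (by omega)
      have hgB := hbox (K + n) (i + n) (by omega)
      have hdiff : |g K i - g (K + n) (i + n)| ≤ γ := abs_sub_le_of_pos_le hgA.1 hgA.2 hgB.1 hgB.2
      have hpow : θ ^ (j - i) ≤ θ ^ A * θ ^ (J - i) := by
        rw [← pow_add]
        exact pow_le_pow_of_le_one hθ0 hθ1.le (by omega)
      calc Λ j i * |g K i - g (K + n) (i + n)| ≤ C * θ ^ (j - i) * γ :=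
            mul_le_mul hΛi.2 hdiff (abs_nonneg _) (mul_nonneg hC (pow_nonneg hθ0 _))
        _ ≤ C * (θ ^ A * θ ^ (J - i)) * γ :=
            mul_le_mul_of_nonneg_right (mul_le_mul_of_nonneg_left hpow hC) hγ.le
        _ = C * γ * θ ^ A * θ ^ (J - i) := by ring
    calc ∑ i ∈ range J, Λ j i * |g K i - g (K + n) (i + n)| ≤ ∑ i ∈ range J, C * γ * θ ^ A * θ ^ (J - i) :=
          Finset.sum_le_sum hterm
      _ = C * γ * θ ^ A * ∑ i ∈ range J, θ ^ (J - i) := by rw [Finset.mul_sum]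
      _ ≤ C * γ * θ ^ A * (θ / (1 - θ)) :=
          mul_le_mul_of_nonneg_left (sum_range_pow_sub_le hθ0 hθ1 J) (by positivity)
      _ = c₁ * θ ^ A := by rw [hc₁]; ring
  have hyoung : ∑ i ∈ Ico J (j + 1), Λ j i * |g K i - g (K + n) (i + n)| ≤ C / (1 - θ) * δ := by
    have hterm : ∀ i ∈ Ico J (j + 1), Λ j i * |g K i - g (K + n) (i + n)| ≤ C * δ * θ ^ (j - i) := by
      intro i hi
      have hJi : J ≤ i := (Finset.mem_Ico.mp hi).1
      have hij : i ≤ j := Nat.lt_succ_iff.mp (Finset.mem_Ico.mp hi).2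
      have hΛi := hΛ j i hij
      have hm : |g K i - g (K + n) (i + n)| ≤ δ := by
        rw [abs_sub_comm]
        exact hmatch i (by omega) (by omega)
      calc Λ j i * |g K i - g (K + n) (i + n)| ≤ C * θ ^ (j - i) * δ :=
            mul_le_mul hΛi.2 hm (abs_nonneg _) (mul_nonneg hC (pow_nonneg hθ0 _))
        _ = C * δ * θ ^ (j - i) := by ring
    calc ∑ i ∈ Ico J (j + 1), Λ j i * |g K i - g (K + n) (i + n)| ≤ ∑ i ∈ Ico J (j + 1), C * δ * θ ^ (j - i) :=
          Finset.sum_le_sum hterm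
      _ = C * δ * ∑ i ∈ Ico J (j + 1), θ ^ (j - i) := by rw [Finset.mul_sum]
      _ ≤ C * δ * (1 / (1 - θ)) := by
          -- the reflected geometric sum `Σ_{i∈[J,j]} θ^{j−i} ≤ 1∕(1−θ)` (the step of `KingCurrencyGap.sum_Ico_pow_rev_le`)
          have hgeo : ∑ i ∈ Ico J (j + 1), θ ^ (j - i) ≤ 1 / (1 - θ) := by
            have hrefl : ∑ i ∈ range (j + 1), θ ^ (j - i) = ∑ m ∈ range (j + 1), θ ^ m := by
              have h := Finset.sum_range_reflect (fun m => θ ^ m) (j + 1)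
              simpa only [Nat.add_sub_cancel] using h
            have hg : ∑ m ∈ Ico 0 (j + 1), θ ^ m ≤ θ ^ 0 / (1 - θ) := geom_sum_Ico_le_of_lt_one hθ0 hθ1
            rw [pow_zero, ← Finset.range_eq_Ico, ← hrefl] at hg
            exact (Finset.sum_le_sum_of_subset_of_nonneg
              (fun i hi => mem_range.mpr (Finset.mem_Ico.mp hi).2) fun _ _ _ => pow_nonneg hθ0 _).trans hg
          exact mul_le_mul_of_nonneg_left hgeo (by positivity)
      _ = C / (1 - θ) * δ := by
          field_simp
  have hpartH : |β j (prefixOf (g K) j) - β j (prefixOf (fun i => g (K + n) (i + n)) j)| ≤ c₁ * θ ^ A + C / (1 - θ) * δ := by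
    linarith [hhist, hsplit, hold, hyoung]
  -- assemble: `4γX²δ + Cδ/(1−θ) + c₁θ^A ≤ ε`
  have hδL : (4 * γ * X ^ 2 + C / (1 - θ)) * δ ≤ ε / 3 := by
    have h1 : (4 * γ * X ^ 2 + C / (1 - θ)) * δ ≤ L₁ * δ :=
      mul_le_mul_of_nonneg_right (by rw [hL₁]; linarith) hδpos.le
    have h2 : L₁ * δ = ε / 3 := by rw [hδ]; field_simp
    linarith
  have hAε := hA A le_rfl
  calc |β (j + n) (prefixOf (g (K + n)) (j + n)) - β j (prefixOf (fun i => g (K + n) (i + n)) j)|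
      ≤ |β (j + n) (prefixOf (g (K + n)) (j + n)) - β j (prefixOf (g K) j)|
        + |β j (prefixOf (g K) j) - β j (prefixOf (fun i => g (K + n) (i + n)) j)| := abs_sub_le _ _ _
    _ ≤ 4 * γ * X ^ 2 * δ + (c₁ * θ ^ A + C / (1 - θ) * δ) := add_le_add hpartB hpartH
    _ ≤ ε := by nlinarith

end Summit.QuantumFields.BalabanUV.T4Continuum.Spine.NE4.KingCurrencyNecessity
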